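import Mathlib.RepresentationTheory.Rep.Iso
import Mathlib.CategoryTheory.Abelian.Subcategory
import Mathlib.CategoryTheory.ObjectProperty.EpiMono
import Mathlib.CategoryTheory.Limits.ConcreteCategory.Basic
import Mathlib.Algebra.Category.ModuleCat.Limits
import Mathlib.Topology.Algebra.OpenSubgroup
import HarnessLib

/-!
# The abelian category of DISCRETE (smooth) representations of a topological group: the full
# subcategory of `Rep k Γ` on the modules all of whose stabilisers are open (Harari §4.2's `C_G`)

Topic `Algebra/Homology`; namespace `Literature.Algebra.Homology.DiscreteRep`.  Definitions with bodies
(the object property, the stabiliser subgroup, the category) and theorems; NO named fact, no `sorry`;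
one instance per closure property and the resulting `Abelian` instance (Mathlib's
`CategoryTheory.ObjectProperty` machinery: `Abelian P.FullSubcategory` for `P` containing zero and
closed under kernels, cokernels and finite products — `Mathlib.CategoryTheory.Abelian.Subcategory`).
Written for Route A of the Poitou–Tate programme of crux `stmt-BirchSwinnertonDyer-19295` (cell
`bsd-schneider-ideate`, seat door-c4 gen 12), step G5′-ii of FINDING-door-c3-g13 §3: the duality
theorem for class formations (Harari Thm. 16.21) is phrased with `Ext^r_G(M, C)` in the category of
DISCRETE modules over a PROFINITE group `G`; this file provides that category as an abelian category
(a full subcategory of Mathlib's `Rep k Γ`), the first stone for Mathlib's `Ext` there.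

Source.  D. Harari, *Galois Cohomology and Class Field Theory* (2020), §4.2 [held copy
`book:harari2017-galois-cohomology-class-field-theory`, p. 91], Definition 4.14 (a discrete `G`-module,
for a profinite `G`, is an abelian group with an action of `G` such that `G` acts continuously for
the discrete topology), Remark 4.13 (for a discrete module, continuity of the action is equivalent to
every stabiliser being an open subgroup), and the sentence after Definition 4.14 introducing the
category `C_G` of discrete `G`-modules as a full abelian subcategory of `Mod_G`, with `A = ⋃_U A^U`
over the open subgroups `U`.  Enough injectives of `C_G` (§4.3, p. 93, referring to Appendix,
Example A.35 (c)) is the sequel file `DiscreteRepEnoughInjectives`; the `Ext` of §16.2 are taken in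
`C_G`.  J.-P. Serre, *Galois Cohomology* I §2.1 (same definition).  (Loci corrected 2026-08-27 per the
cell referee's note N-g47-4: an earlier header cited "Def. 4.10 ff." and set a paraphrase in quotation
marks; no declaration changed.)

## What is formalised (`k` a commutative ring, `Γ` a topological group, `Rep k Γ` Mathlib's
## category of ALL `k`-linear representations of the abstract group `Γ`)

* `stabilizer A x : Subgroup Γ` (`{g | A.ρ g x = x}`) and **`IsDiscrete A`** (`∀ x, IsOpen (stabilizer A x)`),
  packaged as the object property **`isDiscrete k Γ : ObjectProperty (Rep k Γ)`**;
  `isDiscrete_iff_forall_isOpen_setOf`.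
* Closure properties: `IsDiscrete.of_injective` / instance `IsClosedUnderSubobjects` (stabilisers are
  preserved by injective equivariant maps), `IsDiscrete.of_surjective` / instance
  `IsClosedUnderQuotients` (a stabiliser in a quotient contains the open stabiliser of a lift —
  `Subgroup.isOpen_mono`), instance `ContainsZero`, **`isClosedUnderLimitsOfShape_of_finite`** (closed
  under limits of any shape with finitely many objects: the stabiliser of a point of a limit contains
  the finite intersection of the stabilisers of its projections, by the concreteness of limits in
  `ModuleCat`), hence instance `IsClosedUnderFiniteProducts` (and kernels / cokernels through
  subobjects / quotients).
* **`DiscreteRep k Γ := (isDiscrete k Γ).FullSubcategory`** with its `Abelian` instance, the inclusion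
  `DiscreteRep.ι : DiscreteRep k Γ ⥤ Rep k Γ`, and `isDiscrete_of_discreteTopology` (every
  representation of a DISCRETE group is discrete: `DiscreteRep k Γ ≌`-candidates for finite layers).

Not here (sequel files): enough injectives and `HasExt` in `DiscreteRepCat` — Harari §4.3 (p. 93) and
Appendix, Example A.35 (c): a discrete module embeds into `⋃_U I^U` for an injective hull `I` in
`Mod_G`, which is injective in `C_G` — file `DiscreteRepEnoughInjectives`; the identification with the
tree's `Literature.ContinuousRep` structures (`DiscreteGaloisModule`) — file `DiscreteRepContinuous`;
the comparison of `Ext` in `DiscreteRepCat` with continuous cohomology (Harari §4.3, derived functors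
of `A ↦ A^G` versus continuous cochains) — open.

## References
* D. Harari, *Galois Cohomology and Class Field Theory* (2020), §4.2, §16.2. [Harari2020]
* J.-P. Serre, *Galois Cohomology*, Springer (1997), I §2.1. [SerreGaloisCohomology1997]
-/

noncomputable section

universe u

namespace Literature.Algebra.Homology

namespace DiscreteRep

open CategoryTheory CategoryTheory.Limits

variable {k Γ : Type u} [CommRing k] [Group Γ]

/-- The stabiliser `{g | ρ(g) x = x}` of a vector of a representation, as a subgroup.
[cite: Harari2020, §4.2, Remark 4.13 and Definition 4.14] -/
def stabilizer (A : Rep.{u} k Γ) (x : A.V) : Subgroup Γ where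
  carrier := {g | A.ρ g x = x}
  mul_mem' {g h} hg hh := by
    change A.ρ (g * h) x = x
    rw [map_mul, Module.End.mul_apply, hh, hg]
  one_mem' := by
    change A.ρ 1 x = x
    rw [map_one, Module.End.one_apply]
  inv_mem' {g} hg := by
    change A.ρ g⁻¹ x = x
    conv_lhs => rw [← hg]
    rw [← Module.End.mul_apply, ← map_mul, inv_mul_cancel, map_one, Module.End.one_apply]

/-- `g ∈ stabilizer A x ↔ ρ(g) x = x`. [cite: Harari2020, §4.2, Remark 4.13] -/
@[simp]
theorem mem_stabilizer_iff (A : Rep.{u} k Γ) (x : A.V) (g : Γ) :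
    g ∈ stabilizer A x ↔ A.ρ g x = x := Iff.rfl

variable [TopologicalSpace Γ]

/-- **A representation is DISCRETE (smooth) if every stabiliser is open** — Harari's / Serre's
discrete `G`-modules, for the discrete topology on the module.
[cite: Harari2020, §4.2, Definition 4.14 with Remark 4.13] -/
def IsDiscrete (A : Rep.{u} k Γ) : Prop := ∀ x : A.V, IsOpen (stabilizer A x : Set Γ)

/-- Unfolding: discreteness is openness of all the sets `{g | ρ(g) x = x}`. [cite: Harari2020, §4.2] -/
theorem isDiscrete_iff_forall_isOpen_setOf (A : Rep.{u} k Γ) :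
    IsDiscrete A ↔ ∀ x : A.V, IsOpen {g : Γ | A.ρ g x = x} := Iff.rfl

variable (k Γ) in
/-- Discreteness as a property of objects of `Rep k Γ`. [cite: Harari2020, §4.2] -/
def isDiscrete : ObjectProperty (Rep.{u} k Γ) := fun A => IsDiscrete A

/-- Unfolding. [cite: Harari2020, §4.2] -/
@[simp]
theorem isDiscrete_iff (A : Rep.{u} k Γ) : isDiscrete k Γ A ↔ IsDiscrete A := Iff.rfl

/-- Every representation of a DISCRETE group is discrete (so for a finite Galois layer
`Gal(E/F)` with the discrete topology all of `Rep k Gal(E/F)` qualifies). [cite: Harari2020, §4.2] -/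
theorem isDiscrete_of_discreteTopology [DiscreteTopology Γ] (A : Rep.{u} k Γ) : IsDiscrete A :=
  fun _ => isOpen_discrete _

/-! ## Closure under subobjects and quotients -/

/-- **Subobjects: an injective equivariant map reflects stabilisers** (`stab(x) = stab(f x)`), so a
subrepresentation of a discrete representation is discrete. [cite: Harari2020, §4.2] -/
theorem IsDiscrete.of_injective {A B : Rep.{u} k Γ} (f : A ⟶ B)
    (hf : Function.Injective f.hom) (hB : IsDiscrete B) : IsDiscrete A := fun x => by
  have h : (stabilizer A x : Set Γ) = stabilizer B (f.hom x) := by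
    ext g
    change A.ρ g x = x ↔ B.ρ g (f.hom x) = f.hom x
    rw [← Rep.hom_comm_apply, hf.eq_iff]
  rw [h]
  exact hB _

variable [IsTopologicalGroup Γ]

/-- **Quotients: the stabiliser of `f x` contains the stabiliser of `x`**, so for `f` onto and `A`
discrete, `B` is discrete (a subgroup containing an open subgroup is open). [cite: Harari2020, §4.2] -/
theorem IsDiscrete.of_surjective {A B : Rep.{u} k Γ} (f : A ⟶ B)
    (hf : Function.Surjective f.hom) (hA : IsDiscrete A) : IsDiscrete B := fun y => by
  obtain ⟨x, rfl⟩ := hf y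
  refine Subgroup.isOpen_mono (H₁ := stabilizer A x) (fun g hg => ?_) (hA x)
  change B.ρ g (f.hom x) = f.hom x
  rw [← Rep.hom_comm_apply, (mem_stabilizer_iff A x g).1 hg]

/-- `isDiscrete` is closed under subobjects (hence under kernels). [cite: Harari2020, §4.2] -/
instance : (isDiscrete k Γ).IsClosedUnderSubobjects where
  prop_of_mono f _ hB := IsDiscrete.of_injective f ((Rep.mono_iff_injective f).1 inferInstance) hB

/-- `isDiscrete` is closed under quotients (hence under cokernels). [cite: Harari2020, §4.2] -/
instance : (isDiscrete k Γ).IsClosedUnderQuotients where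
  prop_of_epi f _ hA := IsDiscrete.of_surjective f ((Rep.epi_iff_surjective f).1 inferInstance) hA

omit [IsTopologicalGroup Γ] in
/-- The zero representation is discrete (all stabilisers are `Γ`), so `isDiscrete` contains a zero
object. [cite: Harari2020, §4.2] -/
instance : (isDiscrete k Γ).ContainsZero where
  exists_zero := ⟨Rep.trivial k Γ PUnit.{u + 1},
    (Rep.isZero_iff (M := Rep.trivial k Γ PUnit.{u + 1})).2 inferInstance, fun x => by
    have h : (stabilizer (Rep.trivial k Γ PUnit.{u + 1}) x : Set Γ) = Set.univ :=
      Set.eq_univ_of_forall fun g => Subsingleton.elim _ _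
    rw [h]
    exact isOpen_univ⟩

/-! ## Closure under finite limits: the stabiliser of a point of a limit -/

omit [TopologicalSpace Γ] [IsTopologicalGroup Γ] in
/-- **In a limit cone of `Rep k Γ`, `ρ(g)` fixes a point as soon as it fixes all its projections**
(the projections of a limit cone are jointly injective: limits in `Rep` are computed in `ModuleCat`,
where they are concrete). [cite: Harari2020, §4.2] -/
theorem ρ_apply_eq_of_forall_π {J : Type u} [SmallCategory J] {F : J ⥤ Rep.{u} k Γ} {c : Cone F}
    (hc : IsLimit c) (g : Γ) (x : c.pt.V)
    (h : ∀ j, g ∈ stabilizer (F.obj j) ((c.π.app j).hom x)) : c.pt.ρ g x = x := by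
  have hc' := isLimitOfPreserves (forget₂ (Rep.{u} k Γ) (ModuleCat.{u} k)) hc
  refine Concrete.isLimit_ext (F ⋙ forget₂ (Rep.{u} k Γ) (ModuleCat.{u} k)) hc' (c.pt.ρ g x) x
    fun j => ?_
  change (c.π.app j).hom (c.pt.ρ g x) = (c.π.app j).hom x
  exact (Rep.hom_comm_apply (c.π.app j) g x).trans (h j)

/-- **`isDiscrete` is closed under limits of any shape with finitely many objects**: the stabiliser of a
point of the limit contains the (open) finite intersection of the stabilisers of its projections.
[cite: Harari2020, §4.2] -/
theorem isClosedUnderLimitsOfShape_of_finite (J : Type u) [SmallCategory J] [Finite J] :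
    (isDiscrete k Γ).IsClosedUnderLimitsOfShape J := by
  refine ObjectProperty.IsClosedUnderLimitsOfShape.mk' ?_
  rintro _ ⟨F, hF⟩ x
  refine Subgroup.isOpen_mono (H₁ := ⨅ j, stabilizer (F.obj j) ((limit.π F j).hom x)) ?_ ?_
  · intro g hg
    exact ρ_apply_eq_of_forall_π (limit.isLimit F) g x fun j => (Subgroup.mem_iInf.1 hg) j
  · rw [Subgroup.coe_iInf]
    exact isOpen_iInter_of_finite fun j => hF j _

/-- `isDiscrete` is closed under finite products. [cite: Harari2020, §4.2] -/
instance : (isDiscrete k Γ).IsClosedUnderFiniteProducts :=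
  ObjectProperty.IsClosedUnderFiniteProducts.of_isClosedUnderLimitsOfShape.{u}
    fun J _ => isClosedUnderLimitsOfShape_of_finite (Discrete J)

/-! ## The abelian category of discrete representations -/

variable (k Γ) in
/-- **The category `C_Γ` of discrete (smooth) `k`-linear representations of the topological group
`Γ`**: the full subcategory of `Rep k Γ` on the objects with open stabilisers. [cite: Harari2020, §4.2] -/
abbrev _root_.Literature.Algebra.Homology.DiscreteRepCat : Type (u + 1) :=
  (isDiscrete k Γ).FullSubcategory

/-- **`C_Γ` is an abelian category** (a full subcategory of the abelian `Rep k Γ` containing `0` and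
closed under kernels, cokernels and finite products — Mathlib's `ObjectProperty` criterion); in print,
`C_G` is introduced as a full abelian subcategory of `Mod_G` in the sentence following Definition 4.14.
[cite: Harari2020, §4.2, after Definition 4.14 (p. 91)] -/
instance : Abelian (DiscreteRepCat k Γ) := inferInstance

variable (k Γ) in
/-- The (fully faithful, exact) inclusion `C_Γ ⥤ Rep k Γ`. [cite: Harari2020, §4.2] -/
abbrev ι : DiscreteRepCat k Γ ⥤ Rep.{u} k Γ := (isDiscrete k Γ).ι

/-- An object of `Rep k Γ` with open stabilisers, as an object of `C_Γ`. [cite: Harari2020, §4.2] -/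
abbrev mk (A : Rep.{u} k Γ) (hA : IsDiscrete A) : DiscreteRepCat k Γ := ⟨A, hA⟩

/-- For a discrete group, every representation is an object of `C_Γ`. [cite: Harari2020, §4.2] -/
abbrev mkOfDiscreteTopology [DiscreteTopology Γ] (A : Rep.{u} k Γ) : DiscreteRepCat k Γ :=
  ⟨A, isDiscrete_of_discreteTopology A⟩

end DiscreteRep

end Literature.Algebra.Homology
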